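import Mathlib
import HarnessLib
import Summits.Ventures.LatticeQCDFlow.Exactness.U1KickDriftWordErgodic
import Summits.Ventures.LatticeQCDFlow.Exactness.U1FTHMCErgodic

/-!
# Field-transformed HMC with ANY integrator word on `U(1)` lattice gauge fields: exact, and uniformly ergodic for short trajectories — the generic statement and the OMF4 instance

HONEST FRAMING: exact (Metropolis-corrected) sampling algorithms for lattice gauge theory;
figures of merit are autocorrelation/cost numbers at stated couplings and volumes; no
continuum-physics claim.

Venture `LatticeQCDFlow` (cell pub-lqcd), topic `Exactness`, FANOUT row 14 (`eng-flowhmc`, engine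
`latflow.fthmc`, family B: HMC for `S∘F − log J` REPORTED through the member `F`, any integrator
word, any `n_md`, `U(1)` rung).  NEW WORK of the cell over this row's `U1WordDoeblin.lean`
(`u1Word_minorised`), `U1KickDriftWordErgodic.lean` (readings of any kick/drift word and of OMF4),
GEN-9's `U1FTHMCErgodic.lean` (`abs_pulledBackAction_le`) and row 7's `conjKernel_minorised` /
`thmc_config_exact`; nothing is cited as a fact; no number.

* §1 THE GENERIC FT STATEMENT.  `Ψ` ANY measurable `Haar^{⊗ι} ⊗ Lebesgue`-preserving involution of
  phase space whose proposed configuration is one drift `e₁(a • p + G_u p)·u` (`Lip G_u = λ < a`,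
  `‖G_u‖ ≤ B₀`) with momentum shift `≤ M`; `F` any measurable equivalence with
  `HasJacobian Haar^{⊗ι} F J`: `u1Word_fthmc_invariant(_gibbsLaw)` — the reported kernel
  `F ∘ K_(S∘F − log J) ∘ F⁻¹` leaves `e^(−S)·Haar^{⊗ι}` and `π_S` invariant (`J > 0` measurable);
  **`u1Word_fthmc_uniformlyErgodic`**, **`u1Word_fthmc_invariant_unique`** — with `0 < j₁ ≤ J ≤ j₂`
  and measurable `|S| ≤ s`: convergence to `π_S` from EVERY start, uniqueness;
* §2 **`u1Omf4FTHMC_pow_uniformlyErgodic`** / **`_invariant_unique`** — the OMF4 instance at every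
  `nstep` under the conditions of `u1Omf4HMC_pow_uniformlyErgodic`, through any pinched-Jacobian `F`
  (the LO member and the learned layer supply such `F, J`: `U1WilsonFlowLOMemberFTHMCN`,
  `U1MaskedLayerErgodic`).

NOT CLAIMED: Lipschitz constants of forces through members; longer trajectories; `SU(2)`; any usable
`δ`; floating point; any number.
-/

noncomputable section

namespace Summit.Ventures.LatticeQCDFlow.Exactness

open MeasureTheory ProbabilityTheory ProbabilityTheory.Kernel Set Metric
open Literature.MathematicalPhysics.QuantumFieldTheory
open scoped ENNReal NNReal

variable {ι : Type*} [Fintype ι]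

/-! ## §1 FT-HMC with any proposal: exact, Doeblin through the transformation, ergodic -/

section Generic

variable {κ : ℝ} {Ψ : Equiv.Perm ((ι → Circle) × (ι → ℝ))}
  {S : (ι → Circle) → ℝ} {s : ℝ} {F : (ι → Circle) ≃ᵐ (ι → Circle)} {J : (ι → Circle) → ℝ} {j₁ j₂ : ℝ}

/-- **Exactness of FT-HMC with any integrator word**: `Ψ` a measurable `Haar ⊗ Lebesgue`-preserving
involution, `F` with `HasJacobian Haar F J`, `J > 0` measurable: the kernel for `S∘F − log J` reported
through `F` leaves `e^(−S)·Haar^{⊗ι}` invariant (`thmc_config_exact`). -/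
theorem u1Word_fthmc_invariant (hΨ : Measurable ⇑Ψ) (hκ : 0 < κ) (hinv : Function.Involutive ⇑Ψ)
    (hmp : MeasurePreserving ⇑Ψ ((Measure.pi fun _ : ι => haarProbability Circle).prod volume)
      ((Measure.pi fun _ : ι => haarProbability Circle).prod volume))
    (hJ : ∀ v, 0 < J v) (hJm : Measurable J)
    (hF : HasJacobian (Measure.pi fun _ : ι => haarProbability Circle) F fun v => ENNReal.ofReal (J v))
    (hS : Measurable S) :
    Invariant (conjKernel (refreshUpdate (involMH _ hΨ
        fun z : (ι → Circle) × (ι → ℝ) => (S (F z.1) - Real.log (J z.1)) + u1Kinetic κ z.2)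
        (u1MomentumLaw κ)) F)
      ((Measure.pi fun _ : ι => haarProbability Circle).withDensity
        fun u => ENNReal.ofReal (Real.exp (-S u))) :=
  thmc_config_exact (vol := Measure.pi fun _ : ι => haarProbability Circle)
    (volP := volume) (hΦ := hΨ) hJ hJm hF hS (measurable_u1Kinetic κ) hinv hmp
    (u1MomentumWeight_univ_ne_zero hκ) (u1MomentumWeight_univ_ne_top hκ)

/-- … and `π_S` is invariant. -/
theorem u1Word_fthmc_invariant_gibbsLaw (hΨ : Measurable ⇑Ψ) (hκ : 0 < κ)
    (hinv : Function.Involutive ⇑Ψ)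
    (hmp : MeasurePreserving ⇑Ψ ((Measure.pi fun _ : ι => haarProbability Circle).prod volume)
      ((Measure.pi fun _ : ι => haarProbability Circle).prod volume))
    (hJ : ∀ v, 0 < J v) (hJm : Measurable J)
    (hF : HasJacobian (Measure.pi fun _ : ι => haarProbability Circle) F fun v => ENNReal.ofReal (J v))
    (hS : Measurable S) :
    Invariant (conjKernel (refreshUpdate (involMH _ hΨ
        fun z : (ι → Circle) × (ι → ℝ) => (S (F z.1) - Real.log (J z.1)) + u1Kinetic κ z.2)
        (u1MomentumLaw κ)) F) (u1GibbsLaw S) :=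
  invariant_smul (u1Word_fthmc_invariant hΨ hκ hinv hmp hJ hJm hF hS) _

/-- **FT-HMC WITH ANY INTEGRATOR WORD ON `U(1)^ι` IS UNIFORMLY ERGODIC FOR SHORT TRAJECTORIES.**
`Ψ` as above with the one-drift configuration readings (`a > 0`, `Lip G_u = λ < a`, `‖G_u‖ ≤ B₀`,
momentum shift `≤ M`); `F` with a PINCHED certified Jacobian `0 < j₁ ≤ J ≤ j₂`; measurable
`|S| ≤ s`; `κ > 0`: `|μ₀K̃ᵗ(A) − π_S(A)| ≤ (1 − δ)ᵗ` for some `δ ∈ (0, 1]`, EVERY initial law. -/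
theorem u1Word_fthmc_uniformlyErgodic (hΨ : Measurable ⇑Ψ) (hκ : 0 < κ)
    (hinv : Function.Involutive ⇑Ψ)
    (hmp : MeasurePreserving ⇑Ψ ((Measure.pi fun _ : ι => haarProbability Circle).prod volume)
      ((Measure.pi fun _ : ι => haarProbability Circle).prod volume))
    {a : ℝ} (ha : 0 < a) {lam : ℝ≥0} (hlam : (lam : ℝ) < a) {B₀ M : ℝ} (hM : 0 ≤ M)
    (hfst : ∀ u, ∃ G : (ι → ℝ) → ι → ℝ, (∀ p, ‖G p‖ ≤ B₀) ∧ LipschitzWith lam G ∧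
      ∀ p, (Ψ (u, p)).1 = u1ExpDrift 1 (a • p + G p) * u)
    (hsnd : ∀ u p, ‖(Ψ (u, p)).2‖ ≤ ‖p‖ + M)
    (hS : Measurable S) (hs : ∀ u, |S u| ≤ s)
    (hj₁ : 0 < j₁) (hJ₁ : ∀ v, j₁ ≤ J v) (hJ₂ : ∀ v, J v ≤ j₂) (hJm : Measurable J)
    (hF : HasJacobian (Measure.pi fun _ : ι => haarProbability Circle) F fun v => ENNReal.ofReal (J v)) :
    ∃ δ : ℝ, 0 < δ ∧ δ ≤ 1 ∧ ∀ (μ₀ : Measure (ι → Circle)) [IsProbabilityMeasure μ₀] (t : ℕ)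
      (A : Set (ι → Circle)),
      |((fun m : Measure (ι → Circle) =>
            m.bind (conjKernel (refreshUpdate (involMH _ hΨ
              fun z : (ι → Circle) × (ι → ℝ) => (S (F z.1) - Real.log (J z.1)) + u1Kinetic κ z.2)
              (u1MomentumLaw κ)) F))^[t] μ₀).real A - (u1GibbsLaw S).real A| ≤ (1 - δ) ^ t := by
  haveI : Fact (0 < κ) := ⟨hκ⟩
  haveI := isProbabilityMeasure_u1GibbsLaw (ι := ι) hs
  have hJ : ∀ v, 0 < J v := fun v => hj₁.trans_le (hJ₁ v)
  have hSt : Measurable fun v : ι → Circle => S (F v) - Real.log (J v) :=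
    (hS.comp F.measurable).sub (Real.measurable_log.comp hJm)
  obtain ⟨δ, hδ0, hmin⟩ := u1Word_minorised hΨ hκ ha hlam hM hfst hsnd hSt
    (abs_pulledBackAction_le hs hj₁ hJ₁ hJ₂)
  have hmin' := fun x => conjKernel_minorised hmin F x
  have hH : Measurable fun z : (ι → Circle) × (ι → ℝ) =>
      (S (F z.1) - Real.log (J z.1)) + u1Kinetic κ z.2 :=
    (hSt.comp measurable_fst).add ((measurable_u1Kinetic κ).comp measurable_snd)
  haveI : Fact (Measurable fun z : (ι → Circle) × (ι → ℝ) =>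
      (S (F z.1) - Real.log (J z.1)) + u1Kinetic κ z.2) := ⟨hH⟩
  haveI : IsMarkovKernel (refreshUpdate (involMH _ hΨ
      fun z : (ι → Circle) × (ι → ℝ) => (S (F z.1) - Real.log (J z.1)) + u1Kinetic κ z.2)
      (u1MomentumLaw κ)) := by infer_instance
  haveI : IsProbabilityMeasure ((Measure.pi fun _ : ι => haarProbability Circle).map F) :=
    Measure.isProbabilityMeasure_map F.measurable.aemeasurable
  have hδ1 : δ ≤ 1 := by
    have h := Measure.le_iff'.1 (hmin fun _ => 1) univ
    rwa [Measure.smul_apply, smul_eq_mul, measure_univ, measure_univ, mul_one] at h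
  have hδtop : δ ≠ ⊤ := ne_top_of_le_ne_top ENNReal.one_ne_top hδ1
  refine ⟨δ.toReal, ENNReal.toReal_pos hδ0.ne' hδtop,
    ENNReal.toReal_le_of_le_ofReal zero_le_one (by rwa [ENNReal.ofReal_one]), fun μ₀ _ t A => ?_⟩
  exact uniformlyErgodic_of_minorised hmin' (u1Word_fthmc_invariant_gibbsLaw hΨ hκ hinv hmp hJ hJm hF hS)
    μ₀ t A

/-- **`π_S` is the unique invariant probability law** of the reported kernel (same hypotheses). -/
theorem u1Word_fthmc_invariant_unique (hΨ : Measurable ⇑Ψ) (hκ : 0 < κ)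
    (hinv : Function.Involutive ⇑Ψ)
    (hmp : MeasurePreserving ⇑Ψ ((Measure.pi fun _ : ι => haarProbability Circle).prod volume)
      ((Measure.pi fun _ : ι => haarProbability Circle).prod volume))
    {a : ℝ} (ha : 0 < a) {lam : ℝ≥0} (hlam : (lam : ℝ) < a) {B₀ M : ℝ} (hM : 0 ≤ M)
    (hfst : ∀ u, ∃ G : (ι → ℝ) → ι → ℝ, (∀ p, ‖G p‖ ≤ B₀) ∧ LipschitzWith lam G ∧
      ∀ p, (Ψ (u, p)).1 = u1ExpDrift 1 (a • p + G p) * u)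
    (hsnd : ∀ u p, ‖(Ψ (u, p)).2‖ ≤ ‖p‖ + M)
    (hS : Measurable S) (hs : ∀ u, |S u| ≤ s)
    (hj₁ : 0 < j₁) (hJ₁ : ∀ v, j₁ ≤ J v) (hJ₂ : ∀ v, J v ≤ j₂) (hJm : Measurable J)
    (hF : HasJacobian (Measure.pi fun _ : ι => haarProbability Circle) F fun v => ENNReal.ofReal (J v))
    {π' : Measure (ι → Circle)} [IsProbabilityMeasure π']
    (hπ' : Invariant (conjKernel (refreshUpdate (involMH _ hΨ
      fun z : (ι → Circle) × (ι → ℝ) => (S (F z.1) - Real.log (J z.1)) + u1Kinetic κ z.2)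
      (u1MomentumLaw κ)) F) π') :
    π' = u1GibbsLaw S := by
  haveI : Fact (0 < κ) := ⟨hκ⟩
  haveI := isProbabilityMeasure_u1GibbsLaw (ι := ι) hs
  have hJ : ∀ v, 0 < J v := fun v => hj₁.trans_le (hJ₁ v)
  have hSt : Measurable fun v : ι → Circle => S (F v) - Real.log (J v) :=
    (hS.comp F.measurable).sub (Real.measurable_log.comp hJm)
  obtain ⟨δ, hδ0, hmin⟩ := u1Word_minorised hΨ hκ ha hlam hM hfst hsnd hSt
    (abs_pulledBackAction_le hs hj₁ hJ₁ hJ₂)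
  have hmin' := fun x => conjKernel_minorised hmin F x
  haveI : Fact (Measurable fun z : (ι → Circle) × (ι → ℝ) =>
      (S (F z.1) - Real.log (J z.1)) + u1Kinetic κ z.2) :=
    ⟨(hSt.comp measurable_fst).add ((measurable_u1Kinetic κ).comp measurable_snd)⟩
  haveI : IsMarkovKernel (refreshUpdate (involMH _ hΨ
      fun z : (ι → Circle) × (ι → ℝ) => (S (F z.1) - Real.log (J z.1)) + u1Kinetic κ z.2)
      (u1MomentumLaw κ)) := by infer_instance
  haveI : IsProbabilityMeasure ((Measure.pi fun _ : ι => haarProbability Circle).map F) :=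
    Measure.isProbabilityMeasure_map F.measurable.aemeasurable
  exact invariant_unique_of_minorised hmin' hδ0
    (u1Word_fthmc_invariant_gibbsLaw hΨ hκ hinv hmp hJ hJm hF hS) hπ'

end Generic

/-! ## §2 The OMF4 instance -/

section Omf4

variable {r q c κ b c₀ : ℝ} {gᵥ gₗ g_c : (ι → Circle) → ι → ℝ} {L : ℝ≥0}
  {S : (ι → Circle) → ℝ} {s : ℝ} {F : (ι → Circle) ≃ᵐ (ι → Circle)} {J : (ι → Circle) → ℝ} {j₁ j₂ : ℝ}

/-- **`n`-STEP OMF4 FIELD-TRANSFORMED HMC ON `U(1)^ι` IS UNIFORMLY ERGODIC FOR SHORT TRAJECTORIES**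
(hypotheses of `u1Omf4HMC_pow_uniformlyErgodic` on the word; `F` with a pinched certified Jacobian;
the test is on `S∘F − log J`, the chain is reported through `F`). -/
theorem u1Omf4FTHMC_pow_uniformlyErgodic (hb : 0 ≤ b) (hc₀ : 0 ≤ c₀)
    (hbᵥ : ∀ v, ‖gᵥ v‖ ≤ b) (hbₗ : ∀ v, ‖gₗ v‖ ≤ b) (hb_c : ∀ v, ‖g_c v‖ ≤ b)
    (hLᵥ : LipschitzWith L gᵥ) (hLₗ : LipschitzWith L gₗ) (hL_c : LipschitzWith L g_c)
    (hr : |r| ≤ c₀) (hq : |q| ≤ c₀) (hc : |c| ≤ c₀) (hτ0 : 0 < 2 * r + 2 * q + c)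
    (hm : 121 * (L : ℝ) * c₀ ≤ 1 / 2) {n : ℕ} (hn0 : 0 < n)
    (h1 : 3 * (22 * L * (2 * r + 2 * q + c) ^ 2 * (n : ℝ) ^ 2 + 484 * L * c₀ * (2 * r + 2 * q + c) * n +
      5324 * L * c₀ ^ 2) ≤ 2 * r + 2 * q + c)
    (h2 : 22 * L * (2 * r + 2 * q + c) * (n : ℝ) ^ 2 + 484 * L * c₀ * n ≤ 1)
    (hgᵥ : Measurable gᵥ) (hgₗ : Measurable gₗ) (hg_c : Measurable g_c)
    (hκ : 0 < κ) (hS : Measurable S) (hs : ∀ u, |S u| ≤ s)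
    (hj₁ : 0 < j₁) (hJ₁ : ∀ v, j₁ ≤ J v) (hJ₂ : ∀ v, J v ≤ j₂) (hJm : Measurable J)
    (hF : HasJacobian (Measure.pi fun _ : ι => haarProbability Circle) F fun v => ENNReal.ofReal (J v)) :
    ∃ δ : ℝ, 0 < δ ∧ δ ≤ 1 ∧ ∀ (μ₀ : Measure (ι → Circle)) [IsProbabilityMeasure μ₀] (t : ℕ)
      (A : Set (ι → Circle)),
      |((fun m : Measure (ι → Circle) =>
            m.bind (conjKernel (refreshUpdate (involMH _
              (measurable_u1Omf4Proposal_pow r q c gᵥ gₗ g_c hgᵥ hgₗ hg_c n)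
              fun z : (ι → Circle) × (ι → ℝ) => (S (F z.1) - Real.log (J z.1)) + u1Kinetic κ z.2)
              (u1MomentumLaw κ)) F))^[t] μ₀).real A - (u1GibbsLaw S).real A| ≤ (1 - δ) ^ t := by
  obtain ⟨hfst, hsnd⟩ := u1Omf4_pow_readings (ι := ι) hb hc₀ hbᵥ hbₗ hb_c hLᵥ hLₗ hL_c hr hq hc hτ0
    hm (n := n) h1 h2
  have hnR : (0 : ℝ) < n := by exact_mod_cast hn0
  have ha : (0 : ℝ) < n * (2 * r + 2 * q + c) := by positivity
  have hlam : ((Real.toNNReal (n * |2 * r + 2 * q + c| / 3) : ℝ≥0) : ℝ) < n * (2 * r + 2 * q + c) := by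
    rw [Real.coe_toNNReal _ (by positivity), abs_of_pos hτ0]
    nlinarith
  exact u1Word_fthmc_uniformlyErgodic _ hκ (involutive_u1Omf4Proposal_pow r q c gᵥ gₗ g_c n)
    (measurePreserving_u1Omf4Proposal_pow r q c gᵥ gₗ g_c hgᵥ hgₗ hg_c n) ha hlam (by positivity)
    hfst hsnd hS hs hj₁ hJ₁ hJ₂ hJm hF

/-- **`π_S` is the unique invariant probability law of `n`-step OMF4 FT-HMC on `U(1)^ι`** (same
hypotheses). -/
theorem u1Omf4FTHMC_pow_invariant_unique (hb : 0 ≤ b) (hc₀ : 0 ≤ c₀)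
    (hbᵥ : ∀ v, ‖gᵥ v‖ ≤ b) (hbₗ : ∀ v, ‖gₗ v‖ ≤ b) (hb_c : ∀ v, ‖g_c v‖ ≤ b)
    (hLᵥ : LipschitzWith L gᵥ) (hLₗ : LipschitzWith L gₗ) (hL_c : LipschitzWith L g_c)
    (hr : |r| ≤ c₀) (hq : |q| ≤ c₀) (hc : |c| ≤ c₀) (hτ0 : 0 < 2 * r + 2 * q + c)
    (hm : 121 * (L : ℝ) * c₀ ≤ 1 / 2) {n : ℕ} (hn0 : 0 < n)
    (h1 : 3 * (22 * L * (2 * r + 2 * q + c) ^ 2 * (n : ℝ) ^ 2 + 484 * L * c₀ * (2 * r + 2 * q + c) * n +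
      5324 * L * c₀ ^ 2) ≤ 2 * r + 2 * q + c)
    (h2 : 22 * L * (2 * r + 2 * q + c) * (n : ℝ) ^ 2 + 484 * L * c₀ * n ≤ 1)
    (hgᵥ : Measurable gᵥ) (hgₗ : Measurable gₗ) (hg_c : Measurable g_c)
    (hκ : 0 < κ) (hS : Measurable S) (hs : ∀ u, |S u| ≤ s)
    (hj₁ : 0 < j₁) (hJ₁ : ∀ v, j₁ ≤ J v) (hJ₂ : ∀ v, J v ≤ j₂) (hJm : Measurable J)
    (hF : HasJacobian (Measure.pi fun _ : ι => haarProbability Circle) F fun v => ENNReal.ofReal (J v))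
    {π' : Measure (ι → Circle)} [IsProbabilityMeasure π']
    (hπ' : Invariant (conjKernel (refreshUpdate (involMH _
        (measurable_u1Omf4Proposal_pow r q c gᵥ gₗ g_c hgᵥ hgₗ hg_c n)
        fun z : (ι → Circle) × (ι → ℝ) => (S (F z.1) - Real.log (J z.1)) + u1Kinetic κ z.2)
        (u1MomentumLaw κ)) F) π') :
    π' = u1GibbsLaw S := by
  obtain ⟨hfst, hsnd⟩ := u1Omf4_pow_readings (ι := ι) hb hc₀ hbᵥ hbₗ hb_c hLᵥ hLₗ hL_c hr hq hc hτ0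
    hm (n := n) h1 h2
  have hnR : (0 : ℝ) < n := by exact_mod_cast hn0
  have ha : (0 : ℝ) < n * (2 * r + 2 * q + c) := by positivity
  have hlam : ((Real.toNNReal (n * |2 * r + 2 * q + c| / 3) : ℝ≥0) : ℝ) < n * (2 * r + 2 * q + c) := by
    rw [Real.coe_toNNReal _ (by positivity), abs_of_pos hτ0]
    nlinarith
  exact u1Word_fthmc_invariant_unique _ hκ (involutive_u1Omf4Proposal_pow r q c gᵥ gₗ g_c n)
    (measurePreserving_u1Omf4Proposal_pow r q c gᵥ gₗ g_c hgᵥ hgₗ hg_c n) ha hlam (by positivity)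
    hfst hsnd hS hs hj₁ hJ₁ hJ₂ hJm hF hπ'

end Omf4

end Summit.Ventures.LatticeQCDFlow.Exactness
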